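import Summits.CriticalPhenomena.PercolationContinuityZ3.Theorems.PercNearOneGluingNoHeavyLowerTailSahiCombTriWStrataTwo
import Summits.CriticalPhenomena.PercolationContinuityZ3.Theorems.PercNearOneGluingNoHeavyLowerTailSahiCombTriWRungTwo
import Summits.CriticalPhenomena.PercolationContinuityZ3.Theorems.PercNearOneGluingNoHeavyLowerTailSahiCombTriWAntiNestedKernelProof
import Summits.CriticalPhenomena.PercolationContinuityZ3.Theorems.PercNearOneGluingNoHeavyLowerTailSahiCombFourChainIneq

/-!
# `TRI_W(2) ≥ 0` on the stratum ``F ∅ = G ∅`` — a machine-found, kernel-checked pointwise certificate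

Support file of the one-cut programme (crux `NoHeavyLowerTail`, stmt-CriticalPhenomena-4575; cell `prim-masterthm`, seat P5 gen 26;
memo `FROM-prim-masterthm-p5-g26-*.md`).  Target `FiveUpSet.TriWIneq` (`…SahiCombTriWGeneral`), OPEN for index cubes of dimension `a ≥ 2`.
At `a = 2` the pair reduction `LatticeFiveUpSet.triW_nonneg_of_pair_nonneg` reduces it to
`0 ≤ triWOne c P F₀ F₁ G₀ G₁ + triWOne c P Fp Fq Gp Gq` for two diamonds of up-sets `F₀ ⊆ Fp, Fq ⊆ F₁`, `G₀ ⊆ Gp, Gq ⊆ G₁`.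
This file proves that inequality on the stratum ``F ∅ = G ∅`` by a POINTWISE CERTIFICATE: `4` times the sum dominates a non-negative integer
combination of `8` instances of tree theorems (Kleitman's antipodal lemma `card_inter_refl_le`, the five-up-set theorem `fiveUpSetIneq_holds`,
the top-fibre inequality `topFibre_le`, the rung theorem `rung_two_le`, the six-up-set inequality `sixUpSet_le`, the four-chain inequalities
`fourChainIneq_holds` / `antiNestedChainHall_holds`, the bot-empty stratum `inner_pair_le_of_bot_empty`), and the remainder is a sum over the points
`w` of the cube of a function of the positions of `w, wᶜ` in the two diamonds and in `P` that is non-negative in every case allowed by the stratum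
(kernel `decide`).  The certificate was found by an LP over the 2628 antipodal pair types (column generation over ≈ 1.7·10⁵ symmetrised atom
instances; P5 gen 26, kit job in the memo); the SAME LP is INFEASIBLE for the unrestricted statement (fooling value `8/31`), so no certificate of
this shape proves `TriWIneq` at `a = 2` in general.
HONEST LABEL: one new unconditional stratum of `TriWIneq` at `a = 2`; `TriWIneq` itself remains OPEN. [this work]
-/

namespace Summit.CriticalPhenomena.PercolationContinuityZ3.Theorems

namespace FiveUpSet

open Finset LatticeFiveUpSet

variable {γ : Type} [DecidableEq γ] [Fintype γ]

/-- The thin-edge functional on a cube, written out in the twenty atoms `#(P ∩ X ∩ Y)` (general form of the `e0/e1` rewrites of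
`…SahiCombTriWBotEmpty`). [this work] -/
theorem triWOne_expand (P A B C D : Finset (Finset γ)) :
    triWOne (complEquiv γ) P A B C D
      = 2 * (((P ∩ A ∩ C).card : ℤ) + ((P ∩ B ∩ D).card : ℤ))
        - (((P ∩ refl A ∩ D).card : ℤ) + ((P ∩ refl B ∩ C).card : ℤ))
        - (((P ∩ A ∩ refl D).card : ℤ) + ((P ∩ B ∩ refl C).card : ℤ))
        - (((P ∩ refl A ∩ refl C).card : ℤ) + ((P ∩ refl B ∩ refl D).card : ℤ))
        + (((P ∩ refl A ∩ refl D).card : ℤ) + ((P ∩ refl B ∩ refl C).card : ℤ)) := by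
  unfold LatticeFiveUpSet.triWOne
  simp only [image_complEquiv]

set_option maxHeartbeats 400000 in
/-- **`TRI_W(2) ≥ 0` on the stratum ``F ∅ = G ∅``, pair form** (pointwise certificate: `8` atom instances, multiplier `4`,
remainder non-negative on every local type allowed by the stratum; found by LP column generation, P5 gen 26). [this work] -/
theorem inner_pair_le_of_commonBottom (P F₀ Fp Fq F₁ G₀ Gp Gq G₁ : Finset (Finset γ)) (hP : IsUpperSet (P : Set (Finset γ)))
    (_hF₀ : IsUpperSet (F₀ : Set (Finset γ))) (hFp : IsUpperSet (Fp : Set (Finset γ))) (hFq : IsUpperSet (Fq : Set (Finset γ)))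
    (hF₁ : IsUpperSet (F₁ : Set (Finset γ))) (_hG₀ : IsUpperSet (G₀ : Set (Finset γ))) (hGp : IsUpperSet (Gp : Set (Finset γ)))
    (hGq : IsUpperSet (Gq : Set (Finset γ))) (hG₁ : IsUpperSet (G₁ : Set (Finset γ)))
    (hF0p : F₀ ⊆ Fp) (hF0q : F₀ ⊆ Fq) (hFp1 : Fp ⊆ F₁) (hFq1 : Fq ⊆ F₁)
    (hG0p : G₀ ⊆ Gp) (hG0q : G₀ ⊆ Gq) (hGp1 : Gp ⊆ G₁) (hGq1 : Gq ⊆ G₁) (hFG0 : G₀ = F₀) :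
    0 ≤ triWOne (complEquiv γ) P F₀ F₁ G₀ G₁ + triWOne (complEquiv γ) P Fp Fq Gp Gq := by
  rw [triWOne_expand, triWOne_expand]
  have hW : IsUpperSet ((univ : Finset (Finset γ)) : Set (Finset γ)) := by rw [coe_univ]; exact isUpperSet_univ
  have hMF : IsUpperSet ((Fp ∩ Fq : Finset (Finset γ)) : Set (Finset γ)) := by rw [coe_inter]; exact hFp.inter hFq
  have hMG : IsUpperSet ((Gp ∩ Gq : Finset (Finset γ)) : Set (Finset γ)) := by rw [coe_inter]; exact hGp.inter hGq
  have hJF : IsUpperSet ((Fp ∪ Fq : Finset (Finset γ)) : Set (Finset γ)) := by rw [coe_union]; exact hFp.union hFq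
  have hJG : IsUpperSet ((Gp ∪ Gq : Finset (Finset γ)) : Set (Finset γ)) := by rw [coe_union]; exact hGp.union hGq
  have h1 := topFibre_le P ∅ Fp (Gp ∩ Gq) Gp hP isUpperSet_empty hFp hMG hGp (empty_subset _) inter_subset_left
  have h1' : 0 ≤ 2 * ((P ∩ Fp ∩ Gp).card : ℤ) - ((P ∩ Gp ∩ refl ∅).card : ℤ) - ((P ∩ Fp ∩ refl (Gp ∩ Gq)).card : ℤ) - ((P ∩ refl (Fp ∩ (Gp \ (Gp ∩ Gq)))).card : ℤ) - ((P ∩ refl ((Fp \ ∅) ∩ Gp)).card : ℤ) := by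
    have := h1; omega
  have h2 := topFibre_le P ∅ Gp (Fp ∩ Fq) Fp hP isUpperSet_empty hGp hMF hFp (empty_subset _) inter_subset_left
  have h2' : 0 ≤ 2 * ((P ∩ Gp ∩ Fp).card : ℤ) - ((P ∩ Fp ∩ refl ∅).card : ℤ) - ((P ∩ Gp ∩ refl (Fp ∩ Fq)).card : ℤ) - ((P ∩ refl (Gp ∩ (Fp \ (Fp ∩ Fq)))).card : ℤ) - ((P ∩ refl ((Gp \ ∅) ∩ Fp)).card : ℤ) := by
    have := h2; omega
  have h3 := topFibre_le P ∅ Fq (Gp ∩ Gq) Gq hP isUpperSet_empty hFq hMG hGq (empty_subset _) inter_subset_right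
  have h3' : 0 ≤ 2 * ((P ∩ Fq ∩ Gq).card : ℤ) - ((P ∩ Gq ∩ refl ∅).card : ℤ) - ((P ∩ Fq ∩ refl (Gp ∩ Gq)).card : ℤ) - ((P ∩ refl (Fq ∩ (Gq \ (Gp ∩ Gq)))).card : ℤ) - ((P ∩ refl ((Fq \ ∅) ∩ Gq)).card : ℤ) := by
    have := h3; omega
  have h4 := topFibre_le P ∅ Gq (Fp ∩ Fq) Fq hP isUpperSet_empty hGq hMF hFq (empty_subset _) inter_subset_right
  have h4' : 0 ≤ 2 * ((P ∩ Gq ∩ Fq).card : ℤ) - ((P ∩ Fq ∩ refl ∅).card : ℤ) - ((P ∩ Gq ∩ refl (Fp ∩ Fq)).card : ℤ) - ((P ∩ refl (Gq ∩ (Fq \ (Fp ∩ Fq)))).card : ℤ) - ((P ∩ refl ((Gq \ ∅) ∩ Fq)).card : ℤ) := by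
    have := h4; omega
  have h5 := inner_pair_le_of_bot_empty P ∅ (Fp ∪ Fq) F₁ (Gp ∪ Gq) ∅ G₁ hP isUpperSet_empty hJF hF₁ hJG isUpperSet_empty hG₁ (empty_subset _) (union_subset hFp1 hFq1) (union_subset hGp1 hGq1) (empty_subset _)
  rw [triWOne_expand, triWOne_expand] at h5
  have h5' : 0 ≤ (2 * (((P ∩ ∅ ∩ ∅).card : ℤ) + ((P ∩ F₁ ∩ G₁).card : ℤ)) - (((P ∩ refl ∅ ∩ G₁).card : ℤ) + ((P ∩ refl F₁ ∩ ∅).card : ℤ)) - (((P ∩ ∅ ∩ refl G₁).card : ℤ) + ((P ∩ F₁ ∩ refl ∅).card : ℤ)) - (((P ∩ refl ∅ ∩ refl ∅).card : ℤ) + ((P ∩ refl F₁ ∩ refl G₁).card : ℤ)) + (((P ∩ refl ∅ ∩ refl G₁).card : ℤ) + ((P ∩ refl F₁ ∩ refl ∅).card : ℤ))) + (2 * (((P ∩ ∅ ∩ (Gp ∪ Gq)).card : ℤ) + ((P ∩ (Fp ∪ Fq) ∩ ∅).card : ℤ)) - (((P ∩ refl ∅ ∩ ∅).card : ℤ) +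 ((P ∩ refl (Fp ∪ Fq) ∩ (Gp ∪ Gq)).card : ℤ)) - (((P ∩ ∅ ∩ refl ∅).card : ℤ) + ((P ∩ (Fp ∪ Fq) ∩ refl (Gp ∪ Gq)).card : ℤ)) - (((P ∩ refl ∅ ∩ refl (Gp ∪ Gq)).card : ℤ) + ((P ∩ refl (Fp ∪ Fq) ∩ refl ∅).card : ℤ)) + (((P ∩ refl ∅ ∩ refl ∅).card : ℤ) + ((P ∩ refl (Fp ∪ Fq) ∩ refl (Gp ∪ Gq)).card : ℤ))) := by
    have := h5; linarith
  have h6 := inner_pair_le_of_bot_empty P ∅ (Gp ∪ Gq) G₁ (Fp ∪ Fq) ∅ F₁ hP isUpperSet_empty hJG hG₁ hJF isUpperSet_empty hF₁ (empty_subset _) (union_subset hGp1 hGq1) (union_subset hFp1 hFq1) (empty_subset _)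
  rw [triWOne_expand, triWOne_expand] at h6
  have h6' : 0 ≤ (2 * (((P ∩ ∅ ∩ ∅).card : ℤ) + ((P ∩ G₁ ∩ F₁).card : ℤ)) - (((P ∩ refl ∅ ∩ F₁).card : ℤ) + ((P ∩ refl G₁ ∩ ∅).card : ℤ)) - (((P ∩ ∅ ∩ refl F₁).card : ℤ) + ((P ∩ G₁ ∩ refl ∅).card : ℤ)) - (((P ∩ refl ∅ ∩ refl ∅).card : ℤ) + ((P ∩ refl G₁ ∩ refl F₁).card : ℤ)) + (((P ∩ refl ∅ ∩ refl F₁).card : ℤ) + ((P ∩ refl G₁ ∩ refl ∅).card : ℤ))) + (2 * (((P ∩ ∅ ∩ (Fp ∪ Fq)).card : ℤ) + ((P ∩ (Gp ∪ Gq) ∩ ∅).card : ℤ)) - (((P ∩ refl ∅ ∩ ∅).card : ℤ) + ((P ∩ refl (Gp ∪ Gq) ∩ (Fp ∪ Fq)).card : ℤ)) - (((P ∩ ∅ ∩ refl ∅).card : ℤ) + ((P ∩ (Gp ∪ Gq) ∩ refl (Fp ∪ Fq)).card : ℤ)) - (((P ∩ refl ∅ ∩ refl (Fp ∪ Fq)).card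 : ℤ) + ((P ∩ refl (Gp ∪ Gq) ∩ refl ∅).card : ℤ)) + (((P ∩ refl ∅ ∩ refl ∅).card : ℤ) + ((P ∩ refl (Gp ∪ Gq) ∩ refl (Fp ∪ Fq)).card : ℤ))) := by
    have := h6; linarith
  have h7 := inner_pair_le_of_bot_empty P ∅ (Fp ∪ Fq) F₁ (Gp ∪ Gq) ∅ G₁ hP isUpperSet_empty hJF hF₁ hJG isUpperSet_empty hG₁ (empty_subset _) (union_subset hFp1 hFq1) (union_subset hGp1 hGq1) (empty_subset _)
  rw [triWOne_expand, triWOne_expand] at h7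
  have h7' : 0 ≤ (2 * (((P ∩ ∅ ∩ ∅).card : ℤ) + ((P ∩ F₁ ∩ G₁).card : ℤ)) - (((P ∩ refl ∅ ∩ G₁).card : ℤ) + ((P ∩ refl F₁ ∩ ∅).card : ℤ)) - (((P ∩ ∅ ∩ refl G₁).card : ℤ) + ((P ∩ F₁ ∩ refl ∅).card : ℤ)) - (((P ∩ refl ∅ ∩ refl ∅).card : ℤ) + ((P ∩ refl F₁ ∩ refl G₁).card : ℤ)) + (((P ∩ refl ∅ ∩ refl G₁).card : ℤ) + ((P ∩ refl F₁ ∩ refl ∅).card : ℤ))) + (2 * (((P ∩ ∅ ∩ (Gp ∪ Gq)).card : ℤ) + ((P ∩ (Fp ∪ Fq) ∩ ∅).card : ℤ)) - (((P ∩ refl ∅ ∩ ∅).card : ℤ) + ((P ∩ refl (Fp ∪ Fq) ∩ (Gp ∪ Gq)).card : ℤ)) - (((P ∩ ∅ ∩ refl ∅).card : ℤ) + ((P ∩ (Fp ∪ Fq) ∩ refl (Gp ∪ Gq)).card : ℤ)) - (((P ∩ refl ∅ ∩ refl (Gp ∪ Gq)).card : ℤ) + ((P ∩ refl (Fp ∪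 Fq) ∩ refl ∅).card : ℤ)) + (((P ∩ refl ∅ ∩ refl ∅).card : ℤ) + ((P ∩ refl (Fp ∪ Fq) ∩ refl (Gp ∪ Gq)).card : ℤ))) := by
    have := h7; linarith
  have h8 := inner_pair_le_of_bot_empty P ∅ (Gp ∪ Gq) G₁ (Fp ∪ Fq) ∅ F₁ hP isUpperSet_empty hJG hG₁ hJF isUpperSet_empty hF₁ (empty_subset _) (union_subset hGp1 hGq1) (union_subset hFp1 hFq1) (empty_subset _)
  rw [triWOne_expand, triWOne_expand] at h8
  have h8' : 0 ≤ (2 * (((P ∩ ∅ ∩ ∅).card : ℤ) + ((P ∩ G₁ ∩ F₁).card : ℤ)) - (((P ∩ refl ∅ ∩ F₁).card : ℤ) + ((P ∩ refl G₁ ∩ ∅).card : ℤ)) - (((P ∩ ∅ ∩ refl F₁).card : ℤ) + ((P ∩ G₁ ∩ refl ∅).card : ℤ)) - (((P ∩ refl ∅ ∩ refl ∅).card : ℤ) + ((P ∩ refl G₁ ∩ refl F₁).card : ℤ)) + (((P ∩ refl ∅ ∩ refl F₁).card : ℤ) + ((P ∩ refl G₁ ∩ refl ∅).card : ℤ)))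 + (2 * (((P ∩ ∅ ∩ (Fp ∪ Fq)).card : ℤ) + ((P ∩ (Gp ∪ Gq) ∩ ∅).card : ℤ)) - (((P ∩ refl ∅ ∩ ∅).card : ℤ) + ((P ∩ refl (Gp ∪ Gq) ∩ (Fp ∪ Fq)).card : ℤ)) - (((P ∩ ∅ ∩ refl ∅).card : ℤ) + ((P ∩ (Gp ∪ Gq) ∩ refl (Fp ∪ Fq)).card : ℤ)) - (((P ∩ refl ∅ ∩ refl (Fp ∪ Fq)).card : ℤ) + ((P ∩ refl (Gp ∪ Gq) ∩ refl ∅).card : ℤ)) + (((P ∩ refl ∅ ∩ refl ∅).card : ℤ) + ((P ∩ refl (Gp ∪ Gq) ∩ refl (Fp ∪ Fq)).card : ℤ))) := by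
    have := h8; linarith
  have hR : 0 ≤ 4 * ((2 * (((P ∩ F₀ ∩ G₀).card : ℤ) + ((P ∩ F₁ ∩ G₁).card : ℤ)) - (((P ∩ refl F₀ ∩ G₁).card : ℤ) + ((P ∩ refl F₁ ∩ G₀).card : ℤ)) - (((P ∩ F₀ ∩ refl G₁).card : ℤ) + ((P ∩ F₁ ∩ refl G₀).card : ℤ)) - (((P ∩ refl F₀ ∩ refl G₀).card : ℤ) + ((P ∩ refl F₁ ∩ refl G₁).card : ℤ)) + (((P ∩ refl F₀ ∩ refl G₁).card : ℤ) + ((P ∩ refl F₁ ∩ refl G₀).card : ℤ))) + (2 * (((P ∩ Fp ∩ Gp).card : ℤ) + ((P ∩ Fq ∩ Gq).card : ℤ)) - (((P ∩ refl Fp ∩ Gq).card : ℤ) + ((P ∩ refl Fq ∩ Gp).card : ℤ)) - (((P ∩ Fp ∩ refl Gq).card : ℤ) + ((P ∩ Fq ∩ refl Gp).card : ℤ)) - (((P ∩ refl Fp ∩ refl Gp).card : ℤ) + ((P ∩ refl Fq ∩ refl Gq).card : ℤ)) + (((P ∩ refl Fp ∩ refl Gq).card : ℤ) + ((P ∩ refl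 Fq ∩ refl Gp).card : ℤ)))) - (2 * (2 * ((P ∩ Fp ∩ Gp).card : ℤ) - ((P ∩ Gp ∩ refl ∅).card : ℤ) - ((P ∩ Fp ∩ refl (Gp ∩ Gq)).card : ℤ) - ((P ∩ refl (Fp ∩ (Gp \ (Gp ∩ Gq)))).card : ℤ) - ((P ∩ refl ((Fp \ ∅) ∩ Gp)).card : ℤ)) + 2 * (2 * ((P ∩ Gp ∩ Fp).card : ℤ) - ((P ∩ Fp ∩ refl ∅).card : ℤ) - ((P ∩ Gp ∩ refl (Fp ∩ Fq)).card : ℤ) - ((P ∩ refl (Gp ∩ (Fp \ (Fp ∩ Fq)))).card : ℤ) - ((P ∩ refl ((Gp \ ∅) ∩ Fp)).card : ℤ)) + 2 * (2 * ((P ∩ Fq ∩ Gq).card : ℤ) - ((P ∩ Gq ∩ refl ∅).card : ℤ) - ((P ∩ Fq ∩ refl (Gp ∩ Gq)).card : ℤ) - ((P ∩ refl (Fq ∩ (Gq \ (Gp ∩ Gq)))).card : ℤ) - ((P ∩ refl ((Fq \ ∅) ∩ Gq)).card : ℤ)) + 2 * (2 * ((P ∩ Gq ∩ Fq).card : ℤ)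 - ((P ∩ Fq ∩ refl ∅).card : ℤ) - ((P ∩ Gq ∩ refl (Fp ∩ Fq)).card : ℤ) - ((P ∩ refl (Gq ∩ (Fq \ (Fp ∩ Fq)))).card : ℤ) - ((P ∩ refl ((Gq \ ∅) ∩ Fq)).card : ℤ)) + 1 * ((2 * (((P ∩ ∅ ∩ ∅).card : ℤ) + ((P ∩ F₁ ∩ G₁).card : ℤ)) - (((P ∩ refl ∅ ∩ G₁).card : ℤ) + ((P ∩ refl F₁ ∩ ∅).card : ℤ)) - (((P ∩ ∅ ∩ refl G₁).card : ℤ) + ((P ∩ F₁ ∩ refl ∅).card : ℤ)) - (((P ∩ refl ∅ ∩ refl ∅).card : ℤ) + ((P ∩ refl F₁ ∩ refl G₁).card : ℤ)) + (((P ∩ refl ∅ ∩ refl G₁).card : ℤ) + ((P ∩ refl F₁ ∩ refl ∅).card : ℤ))) + (2 * (((P ∩ ∅ ∩ (Gp ∪ Gq)).card : ℤ) + ((P ∩ (Fp ∪ Fq) ∩ ∅).card : ℤ)) - (((P ∩ refl ∅ ∩ ∅).card : ℤ) + ((P ∩ refl (Fp ∪ Fq) ∩ (Gp ∪ Gq)).card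 : ℤ)) - (((P ∩ ∅ ∩ refl ∅).card : ℤ) + ((P ∩ (Fp ∪ Fq) ∩ refl (Gp ∪ Gq)).card : ℤ)) - (((P ∩ refl ∅ ∩ refl (Gp ∪ Gq)).card : ℤ) + ((P ∩ refl (Fp ∪ Fq) ∩ refl ∅).card : ℤ)) + (((P ∩ refl ∅ ∩ refl ∅).card : ℤ) + ((P ∩ refl (Fp ∪ Fq) ∩ refl (Gp ∪ Gq)).card : ℤ)))) + 1 * ((2 * (((P ∩ ∅ ∩ ∅).card : ℤ) + ((P ∩ G₁ ∩ F₁).card : ℤ)) - (((P ∩ refl ∅ ∩ F₁).card : ℤ) + ((P ∩ refl G₁ ∩ ∅).card : ℤ)) - (((P ∩ ∅ ∩ refl F₁).card : ℤ) + ((P ∩ G₁ ∩ refl ∅).card : ℤ)) - (((P ∩ refl ∅ ∩ refl ∅).card : ℤ) + ((P ∩ refl G₁ ∩ refl F₁).card : ℤ)) + (((P ∩ refl ∅ ∩ refl F₁).card : ℤ) + ((P ∩ refl G₁ ∩ refl ∅).card : ℤ))) + (2 * (((P ∩ ∅ ∩ (Fp ∪ Fq)).card : ℤ) + ((P ∩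 (Gp ∪ Gq) ∩ ∅).card : ℤ)) - (((P ∩ refl ∅ ∩ ∅).card : ℤ) + ((P ∩ refl (Gp ∪ Gq) ∩ (Fp ∪ Fq)).card : ℤ)) - (((P ∩ ∅ ∩ refl ∅).card : ℤ) + ((P ∩ (Gp ∪ Gq) ∩ refl (Fp ∪ Fq)).card : ℤ)) - (((P ∩ refl ∅ ∩ refl (Fp ∪ Fq)).card : ℤ) + ((P ∩ refl (Gp ∪ Gq) ∩ refl ∅).card : ℤ)) + (((P ∩ refl ∅ ∩ refl ∅).card : ℤ) + ((P ∩ refl (Gp ∪ Gq) ∩ refl (Fp ∪ Fq)).card : ℤ)))) + 1 * ((2 * (((P ∩ ∅ ∩ ∅).card : ℤ) + ((P ∩ F₁ ∩ G₁).card : ℤ)) - (((P ∩ refl ∅ ∩ G₁).card : ℤ) + ((P ∩ refl F₁ ∩ ∅).card : ℤ)) - (((P ∩ ∅ ∩ refl G₁).card : ℤ) + ((P ∩ F₁ ∩ refl ∅).card : ℤ)) - (((P ∩ refl ∅ ∩ refl ∅).card : ℤ) + ((P ∩ refl F₁ ∩ refl G₁).card : ℤ)) + (((P ∩ refl ∅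 ∩ refl G₁).card : ℤ) + ((P ∩ refl F₁ ∩ refl ∅).card : ℤ))) + (2 * (((P ∩ ∅ ∩ (Gp ∪ Gq)).card : ℤ) + ((P ∩ (Fp ∪ Fq) ∩ ∅).card : ℤ)) - (((P ∩ refl ∅ ∩ ∅).card : ℤ) + ((P ∩ refl (Fp ∪ Fq) ∩ (Gp ∪ Gq)).card : ℤ)) - (((P ∩ ∅ ∩ refl ∅).card : ℤ) + ((P ∩ (Fp ∪ Fq) ∩ refl (Gp ∪ Gq)).card : ℤ)) - (((P ∩ refl ∅ ∩ refl (Gp ∪ Gq)).card : ℤ) + ((P ∩ refl (Fp ∪ Fq) ∩ refl ∅).card : ℤ)) + (((P ∩ refl ∅ ∩ refl ∅).card : ℤ) + ((P ∩ refl (Fp ∪ Fq) ∩ refl (Gp ∪ Gq)).card : ℤ)))) + 1 * ((2 * (((P ∩ ∅ ∩ ∅).card : ℤ) + ((P ∩ G₁ ∩ F₁).card : ℤ)) - (((P ∩ refl ∅ ∩ F₁).card : ℤ) + ((P ∩ refl G₁ ∩ ∅).card : ℤ)) - (((P ∩ ∅ ∩ refl F₁).card : ℤ) + ((P ∩ G₁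 ∩ refl ∅).card : ℤ)) - (((P ∩ refl ∅ ∩ refl ∅).card : ℤ) + ((P ∩ refl G₁ ∩ refl F₁).card : ℤ)) + (((P ∩ refl ∅ ∩ refl F₁).card : ℤ) + ((P ∩ refl G₁ ∩ refl ∅).card : ℤ))) + (2 * (((P ∩ ∅ ∩ (Fp ∪ Fq)).card : ℤ) + ((P ∩ (Gp ∪ Gq) ∩ ∅).card : ℤ)) - (((P ∩ refl ∅ ∩ ∅).card : ℤ) + ((P ∩ refl (Gp ∪ Gq) ∩ (Fp ∪ Fq)).card : ℤ)) - (((P ∩ ∅ ∩ refl ∅).card : ℤ) + ((P ∩ (Gp ∪ Gq) ∩ refl (Fp ∪ Fq)).card : ℤ)) - (((P ∩ refl ∅ ∩ refl (Fp ∪ Fq)).card : ℤ) + ((P ∩ refl (Gp ∪ Gq) ∩ refl ∅).card : ℤ)) + (((P ∩ refl ∅ ∩ refl ∅).card : ℤ) + ((P ∩ refl (Gp ∪ Gq) ∩ refl (Fp ∪ Fq)).card : ℤ))))) := by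
    simp only [card_eq_univ_sum]
    simp only [mem_inter, mem_refl, mem_union, mem_sdiff, Finset.notMem_empty]
    simp only [mul_add, mul_sub]
    simp only [Finset.mul_sum, ← Finset.sum_add_distrib, ← Finset.sum_sub_distrib]
    refine Finset.sum_nonneg (fun w _ => ?_)
    obtain ⟨s₁, a0, ap, aq, a1⟩ := diamond_pos hF0p hF0q hFp1 hFq1 w
    obtain ⟨s₂, b0, bp, bq, b1⟩ := diamond_pos hG0p hG0q hGp1 hGq1 w
    obtain ⟨s₃, c0, cp, cq, c1⟩ := diamond_pos hF0p hF0q hFp1 hFq1 wᶜ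
    obtain ⟨s₄, d0, dp, dq, d1⟩ := diamond_pos hG0p hG0q hGp1 hGq1 wᶜ
    have hs12 : (s₁ = 5 ↔ s₂ = 5) := a0.symm.trans (by rw [← hFG0]; exact b0)
    have hs34 : (s₃ = 5 ↔ s₄ = 5) := c0.symm.trans (by rw [← hFG0]; exact d0)
    simp only [a0, ap, aq, a1, b0, bp, bq, b1, c0, cp, cq, c1, d0, dp, dq, d1]
    clear a0 ap aq a1 b0 bp bq b1 c0 cp cq c1 d0 dp dq d1
    by_cases hp : w ∈ P <;> simp only [hp] <;> revert s₁ s₂ s₃ s₄ <;> decide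
  linarith [hR, h1', h2', h3', h4', h5', h6', h7', h8']

/-- **STRATUM of `TRI_W(2) ≥ 0` (unconditional): the two families agree at the bottom index (`F ∅ = G ∅`).**  Index cube with two atoms `a ≠ b`, up-set `P`, monotone families `F, G` of up-sets of a
finite cube: `0 ≤ triW P F G`.  Pair reduction `LatticeFiveUpSet.triW_nonneg_of_pair_nonneg` + `inner_pair_le_of_commonBottom`. [this work] -/
theorem triW_nonneg_of_commonBottom {β : Type} [DecidableEq β] [Fintype β] {a b : β} (hab : a ≠ b) (hu : (univ : Finset β) = {a, b})
    (P : Finset (Finset γ)) (F G : Finset β → Finset (Finset γ))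
    (hP : IsUpperSet (P : Set (Finset γ))) (hF : ∀ x, IsUpperSet (F x : Set (Finset γ))) (hG : ∀ x, IsUpperSet (G x : Set (Finset γ)))
    (hFm : Monotone F) (hGm : Monotone G) (h0 : G ∅ = F ∅) : 0 ≤ triW P F G := by
  refine LatticeFiveUpSet.triW_nonneg_of_pair_nonneg hab hu P F G ?_
  exact inner_pair_le_of_commonBottom P (F ∅) (F {a}) (F {b}) (F univ) (G ∅) (G {a}) (G {b}) (G univ) hP (hF ∅) (hF {a}) (hF {b}) (hF univ)
    (hG ∅) (hG {a}) (hG {b}) (hG univ) (hFm (empty_subset _)) (hFm (empty_subset _)) (hFm (subset_univ _)) (hFm (subset_univ _))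
    (hGm (empty_subset _)) (hGm (empty_subset _)) (hGm (subset_univ _)) (hGm (subset_univ _)) h0

end FiveUpSet

end Summit.CriticalPhenomena.PercolationContinuityZ3.Theorems
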